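import Mathlib
import Summits.ValiantsHypothesis.ValiantsHypothesis.Theorems.RigidityForcesSymmetryRankRigidMinimalReprLaplaceSupportCore
import Summits.ValiantsHypothesis.ValiantsHypothesis.Theorems.RigidityForcesSymmetryRankRigidMinimalReprLaplaceHybridRows

/-!
# The support-core engine, part 2: the witness construction
# (crux `RankRigidMinimalRepr`, stmt-ValiantsHypothesis-18034; frontier rung `LaplaceOptimalFive`, stmt-24813)

`core_witness`: the SUPPORT-CORE variant of the greedy dual-witness construction (compare `hybrid_witness2`,
`…LaplaceHybridWitness2.lean`).  Slots are processed along an order `ord`; terms `t` are charged to slots `l t` with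
constraint vectors `Nv t φ` depending only on the covectors of slots before `l t` (`hloc`).  All positions are GENERAL
(pivot rows) except the two CORE positions `j0, j0 + 1`: the first core row is chosen with at least three non-zero
coordinates off the earlier pivots (`exists_orthogonal_support_three`), the second is any non-zero solution, and the
`2 × 2` core lemma (`offdiag_ne_zero_of_support_three`) supplies two fresh columns `a ≠ b` on which the two core rows
have a non-zero `2 × 2` permanent; later rows avoid `a, b` as well, and `permanent_eq_of_block` evaluates the permanent.
COUNTS: general position `j`: `#charged + j + 1 ≤ n`; core: `#charged(j0) + j0 + 3 ≤ n` and `#charged(j0+1) + j0 + 1 ≤ n`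
— i.e. capacities `(n-3-j0, n-1-j0)` at the core instead of `(n-1-j0, n-2-j0)`.  At `n = 5` this certifies the three
residual `a = 3` types of `LaplaceOptimal 5` with a quadruple load on one slot (evidence of p8 g11 on stmt-24813).

General `n`; no definitions.  HONEST FRAMING: infrastructure for the frontier rung `LaplaceOptimalFive` (stmt-24813),
which stays OPEN; nothing here bears on `VP ≠ VNP`.
-/

set_option autoImplicit false

-- the mandated summit-side namespace repeats a component by design (single-problem summit)
set_option linter.dupNamespace false

namespace Summit.ValiantsHypothesis.ValiantsHypothesis.Theorems.RigidityForcesSymmetryRankRigidMinimalRepr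

namespace LaplaceTriangular

open Finset

variable {n : ℕ}

/-- **Support-core witness lemma.**  Positions along `ord`; terms `t` charged to slots `l t` with constraint vectors
`Nv t φ` determined by the covectors of earlier slots (`hloc`); core positions `j0, j0 + 1` (`j0 + 2 ≤ n`).  COUNTS: at a
general position `j ∉ {j0, j0+1}`, `#charged + j + 1 ≤ n`; at `j0`, `#charged + j0 + 3 ≤ n`; at `j0 + 1`,
`#charged + j0 + 1 ≤ n`.  Then covectors killing every charged constraint with non-zero permanent exist. -/
theorem core_witness {N : ℕ} (ord : Equiv.Perm (Fin n)) (j0 : ℕ) (hj0 : j0 + 2 ≤ n)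
    (l : Fin N → Fin n) (Nv : Fin N → (Fin n → Fin n → ℂ) → (Fin n → ℂ))
    (hloc : ∀ t, ∀ φ φ' : Fin n → Fin n → ℂ, (∀ s, ord.symm s < ord.symm (l t) → φ s = φ' s) → Nv t φ = Nv t φ')
    (hcount : ∀ j : Fin n, (j : ℕ) ≠ j0 → (j : ℕ) ≠ j0 + 1 →
      (univ.filter (fun t => l t = ord j)).card + (j : ℕ) + 1 ≤ n)
    (hcA : (univ.filter (fun t => l t = ord ⟨j0, by omega⟩)).card + j0 + 3 ≤ n)
    (hcB : (univ.filter (fun t => l t = ord ⟨j0 + 1, by omega⟩)).card + j0 + 1 ≤ n) :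
    ∃ φ : Fin n → Fin n → ℂ,
      (∀ t, ∑ y, φ (l t) y * Nv t φ y = 0) ∧ (Matrix.of fun c i => φ i c).permanent ≠ 0 := by
  classical
  set A : Fin n := ord ⟨j0, by omega⟩ with hA
  set B : Fin n := ord ⟨j0 + 1, by omega⟩ with hB
  have hAB : A ≠ B := by
    intro h; have := ord.injective h; simp [Fin.ext_iff] at this
  have hsA : (ord.symm A : ℕ) = j0 := by rw [hA, Equiv.symm_apply_apply]
  have hsB : (ord.symm B : ℕ) = j0 + 1 := by rw [hB, Equiv.symm_apply_apply]
  -- INVARIANT after processing the positions `< j`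
  have step : ∀ j : ℕ, j ≤ n → ∃ (φ : Fin n → Fin n → ℂ) (c : Fin n → Fin n),
      -- (K) kills so far
      (∀ t, (ord.symm (l t) : ℕ) < j → ∑ y, φ (l t) y * Nv t φ y = 0) ∧
      -- (G) general rows: pivot, vanishing at earlier columns
      (∀ m : Fin n, (m : ℕ) < j → (m : ℕ) ≠ j0 → (m : ℕ) ≠ j0 + 1 →
        φ (ord m) (c m) ≠ 0 ∧ ∀ m' : Fin n, m' < m → φ (ord m) (c m') = 0) ∧
      -- (A1) (A2) the first core row
      (j0 < j → (∀ m' : Fin n, (m' : ℕ) < j0 → φ A (c m') = 0) ∧ 3 ≤ (univ.filter (fun x => φ A x ≠ 0)).card) ∧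
      -- (B1) (B2) the second core row and the core columns
      (j0 + 1 < j → (∀ m' : Fin n, (m' : ℕ) < j0 → φ B (c m') = 0) ∧
        φ A (c ⟨j0, by omega⟩) * φ B (c ⟨j0 + 1, by omega⟩) +
          φ A (c ⟨j0 + 1, by omega⟩) * φ B (c ⟨j0, by omega⟩) ≠ 0) ∧
      -- (I) pivots / core columns are distinct
      (∀ m m' : Fin n, (m : ℕ) < j → (m' : ℕ) < j → c m = c m' → m = m') := by
    intro j
    induction j with
    | zero =>
      intro _
      exact ⟨fun _ _ => 0, fun m => m, fun t ht => absurd ht (by omega), fun m hm => absurd hm (by omega),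
        fun h => absurd h (by omega), fun h => absurd h (by omega), fun m m' hm => absurd hm (by omega)⟩
    | succ j ih =>
      intro hj
      obtain ⟨φ, c, hK, hG, hAc, hBc, hI⟩ := ih (by omega)
      set jf : Fin n := ⟨j, by omega⟩ with hjf
      set s : Fin n := ord jf with hs
      have hsj : ord.symm s = jf := by rw [hs, Equiv.symm_apply_apply]
      have hjs : ∀ m : Fin n, (m : ℕ) < j → ord m ≠ s := fun m hm h => by
        have := ord.injective (h.trans hs); rw [this] at hm; exact lt_irrefl _ hm
      -- columns used so far (for the second core row: the provisional pivot of the first core row is NOT used)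
      let Used : Finset (Fin n) := (univ.filter (fun m : Fin n => (m : ℕ) < j ∧ (j = j0 + 1 → (m : ℕ) ≠ j0))).image c
      have hUsed_mem : ∀ x, x ∈ Used ↔ ∃ m : Fin n, ((m : ℕ) < j ∧ (j = j0 + 1 → (m : ℕ) ≠ j0)) ∧ c m = x := by
        intro x; simp [Used]
      have hUsed_card : Used.card ≤ (if j = j0 + 1 then j0 else j) := by
        refine card_image_le.trans ?_
        split_ifs with h
        · have : (univ.filter (fun m : Fin n => (m : ℕ) < j ∧ (j = j0 + 1 → (m : ℕ) ≠ j0))) =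
              Finset.Iio ⟨j0, by omega⟩ := by
            ext m; simp only [mem_filter, mem_univ, true_and, Finset.mem_Iio, Fin.lt_def]; omega
          rw [this, Fin.card_Iio]
        · have : (univ.filter (fun m : Fin n => (m : ℕ) < j ∧ (j = j0 + 1 → (m : ℕ) ≠ j0))) = Finset.Iio jf := by
            ext m; simp only [mem_filter, mem_univ, true_and, Finset.mem_Iio, Fin.lt_def, hjf]; omega
          rw [this, Fin.card_Iio]
      -- the charged constraint vectors of this slot
      let Bv : Finset (Fin n → ℂ) := (univ.filter (fun t => l t = s)).image (fun t => Nv t φ)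
      have hBv : Bv.card ≤ (univ.filter (fun t => l t = s)).card := card_image_le
      have hBv_mem : ∀ t, l t = s → Nv t φ ∈ Bv := fun t ht => mem_image.mpr ⟨t, by simp [ht], rfl⟩
      -- the linear conditions: kill `Bv`, vanish on `Used`
      let T : Finset (Fin n → ℂ) := Bv ∪ Used.image (fun x => Pi.single x 1)
      have hT_card : T.card ≤ (univ.filter (fun t => l t = s)).card + (if j = j0 + 1 then j0 else j) :=
        (card_union_le _ _).trans (Nat.add_le_add hBv (card_image_le.trans hUsed_card))
      have hT_kill : ∀ ψ : Fin n → ℂ, (∀ a ∈ T, ∑ y, ψ y * a y = 0) →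
          (∀ t, l t = s → ∑ y, ψ y * Nv t φ y = 0) ∧ (∀ x ∈ Used, ψ x = 0) := by
        intro ψ hψ
        refine ⟨fun t ht => hψ _ (mem_union_left _ (hBv_mem t ht)), fun x hx => ?_⟩
        have := hψ (Pi.single x 1) (mem_union_right _ (mem_image.mpr ⟨x, hx, rfl⟩))
        simpa [Pi.single_apply] using this
      -- THE NEW ROW: a uniform package — `ψ` with the linear conditions, and new column values `ca` (position `j0` if
      -- `j = j0 + 1`, else unused) and `cj` (this position)
      obtain ⟨ψ, ca, cj, hψT, hGen, hCoreA, hCoreB⟩ : ∃ (ψ : Fin n → ℂ) (ca cj : Fin n),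
          (∀ a ∈ T, ∑ y, ψ y * a y = 0) ∧
          (j ≠ j0 → j ≠ j0 + 1 → cj ∉ Used ∧ ψ cj ≠ 0) ∧
          (j = j0 → 3 ≤ (univ.filter (fun x => ψ x ≠ 0)).card ∧ ψ cj ≠ 0) ∧
          (j = j0 + 1 → ca ∉ Used ∧ cj ∉ Used ∧ ca ≠ cj ∧ φ A ca * ψ cj + φ A cj * ψ ca ≠ 0) := by
        by_cases hjA : j = j0
        · -- first core row: support three
          have hTc : T.card + 3 ≤ n := by
            have h1 := hT_card; rw [if_neg (by omega)] at h1
            have h2 := hcA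
            have : s = A := by rw [hs, hA]; congr 1; exact Fin.ext hjA
            rw [this] at h1; omega
          obtain ⟨ψ, hψ, hsupp⟩ := exists_orthogonal_support_three T hTc
          obtain ⟨x, hx⟩ : ∃ x, x ∈ univ.filter (fun x => ψ x ≠ 0) := card_pos.mp (by omega)
          refine ⟨ψ, x, x, hψ, fun h => absurd hjA h, fun _ => ⟨hsupp, (mem_filter.mp hx).2⟩, fun h => by omega⟩
        · by_cases hjB : j = j0 + 1
          · -- second core row: non-zero, then the 2 × 2 core
            have hTc : T.card < n := by
              have h1 := hT_card; rw [if_pos hjB] at h1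
              have h2 := hcB
              have : s = B := by rw [hs, hB]; congr 1; exact Fin.ext hjB
              rw [this] at h1; omega
            obtain ⟨ψ, hψ0, hψ⟩ := exists_ne_zero_orthogonal T hTc
            obtain ⟨-, hψU⟩ := hT_kill ψ hψ
            -- the first core row vanishes on `Used` and has support ≥ 3
            obtain ⟨hA1, hA2⟩ := hAc (by omega)
            have hAU : ∀ x ∈ Used, φ A x = 0 := by
              intro x hx
              obtain ⟨m, ⟨hm, hm'⟩, rfl⟩ := (hUsed_mem x).mp hx
              exact hA1 m (by have := hm' hjB; omega)
            let F : Finset (Fin n) := univ.filter (fun x => x ∉ Used)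
            have hF1 : 3 ≤ (F.filter (fun x => φ A x ≠ 0)).card := by
              refine hA2.trans (card_le_card fun x hx => ?_)
              simp only [F, mem_filter, mem_univ, true_and] at hx ⊢
              exact ⟨fun hU => hx (hAU x hU), hx⟩
            have hF2 : ∃ x ∈ F, ψ x ≠ 0 := by
              by_contra h; push Not at h
              apply hψ0; funext x
              by_cases hxU : x ∈ Used
              · exact hψU x hxU
              · exact h x (by simp [F, hxU])
            obtain ⟨a, ha, b, hb, hab, hM⟩ := offdiag_ne_zero_of_support_three F (φ A) ψ hF1 hF2
            simp only [F, mem_filter, mem_univ, true_and] at ha hb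
            exact ⟨ψ, a, b, hψ, fun _ h => absurd hjB h, fun h => by omega, fun _ => ⟨ha, hb, hab, hM⟩⟩
          · -- general row
            have hTc : Bv.card + Used.card < n := by
              have h1 := hUsed_card; rw [if_neg hjB] at h1
              have h2 := hcount jf hjA hjB; rw [← hs] at h2
              have hjv : (jf : ℕ) = j := rfl
              rw [hjv] at h2; omega
            obtain ⟨ψ, cj, hcjU, hψcj, -, hvan, hkB, -⟩ :=
              general_row Used Bv false 0 s hTc (fun h => absurd h (by decide)) (fun h => absurd h (by decide))
            refine ⟨ψ, cj, cj, fun a ha => ?_, fun _ _ => ⟨hcjU, hψcj⟩, fun h => absurd h hjA, fun h => absurd h hjB⟩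
            rcases mem_union.mp ha with ha | ha
            · exact hkB a ha
            · obtain ⟨x, hx, rfl⟩ := mem_image.mp ha
              have := hvan rfl x hx
              simp [Pi.single_apply, this]
      obtain ⟨hψkill, hψU⟩ := hT_kill ψ hψT
      have hψvan : ∀ m : Fin n, (m : ℕ) < j → (j = j0 + 1 → (m : ℕ) ≠ j0) → ψ (c m) = 0 :=
        fun m hm hm' => hψU (c m) ((hUsed_mem _).mpr ⟨m, ⟨hm, hm'⟩, rfl⟩)
      -- EXTENSION: new covectors and columns
      let φ' : Fin n → Fin n → ℂ := Function.update φ s ψ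
      let c' : Fin n → Fin n := fun m => if (m : ℕ) = j then cj else if j = j0 + 1 ∧ (m : ℕ) = j0 then ca else c m
      have hc'old : ∀ m : Fin n, (m : ℕ) < j → (j = j0 + 1 → (m : ℕ) ≠ j0) → c' m = c m := by
        intro m hm hm'
        simp only [c']
        rw [if_neg (by omega), if_neg (by intro h; exact hm' h.1 h.2)]
      have hc'j : c' jf = cj := by simp [c', hjf]
      have hc'new : ∀ m : Fin n, (m : ℕ) = j0 → j = j0 + 1 → c' m = ca := fun m hm h => by
        simp only [c']; rw [if_neg (by omega), if_pos ⟨h, hm⟩]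
      have hc'a : j = j0 + 1 → c' ⟨j0, by omega⟩ = ca := fun h => hc'new _ rfl h
      have hφ'old : ∀ i, i ≠ s → φ' i = φ i := fun i hi => Function.update_of_ne hi _ _
      have hφ's : φ' s = ψ := Function.update_self _ _ _
      have hφ'm : ∀ m : Fin n, (m : ℕ) < j → φ' (ord m) = φ (ord m) := fun m hm => hφ'old _ (hjs m hm)
      -- constraint vectors of terms at positions ≤ j are unchanged
      have hNv : ∀ t, (ord.symm (l t) : ℕ) ≤ j → Nv t φ' = Nv t φ := by
        intro t ht
        refine hloc t _ _ (fun s' hs' => hφ'old s' (fun h => ?_))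
        rw [h, hsj, Fin.lt_def] at hs'
        exact absurd (lt_of_lt_of_le hs' ht) (lt_irrefl _)
      refine ⟨φ', c', ?_, ?_, ?_, ?_, ?_⟩
      · -- (K)
        intro t ht
        rw [hNv t (by omega)]
        rcases Nat.lt_succ_iff_lt_or_eq.mp ht with ht' | ht'
        · have hls : l t ≠ s := fun h => by rw [h, hsj] at ht'; exact lt_irrefl _ ht'
          rw [hφ'old _ hls]; exact hK t ht'
        · have hls : l t = s := by
            have e : ord.symm (l t) = jf := Fin.ext ht'
            calc l t = ord (ord.symm (l t)) := (Equiv.apply_symm_apply _ _).symm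
              _ = s := by rw [e, hs]
          rw [hls, hφ's]; exact hψkill t hls
      · -- (G)
        intro m hm hmA hmB
        rcases Nat.lt_succ_iff_lt_or_eq.mp hm with hm' | hm'
        · obtain ⟨h1, h2⟩ := hG m hm' hmA hmB
          rw [hφ'm m hm', hc'old m hm' (by omega)]
          refine ⟨h1, fun m' hmm => ?_⟩
          rw [hc'old m' (by rw [Fin.lt_def] at hmm; omega) (by rw [Fin.lt_def] at hmm; omega)]
          exact h2 m' hmm
        · have hmj : m = jf := Fin.ext hm'
          subst hmj
          have hjA : j ≠ j0 := hmA
          have hjB : j ≠ j0 + 1 := hmB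
          obtain ⟨-, hψcj⟩ := hGen hjA hjB
          rw [← hs, hφ's, hc'j]
          refine ⟨hψcj, fun m' hmm => ?_⟩
          have hm'j : (m' : ℕ) < j := by rw [Fin.lt_def] at hmm; exact hmm
          rw [hc'old m' hm'j (fun h => absurd h hjB)]
          exact hψvan m' hm'j (fun h => absurd h hjB)
      · -- (A1) (A2)
        intro hjA'
        rcases Nat.lt_succ_iff_lt_or_eq.mp hjA' with h | h
        · -- the first core row was placed earlier
          obtain ⟨h1, h2⟩ := hAc h
          have hAs : A ≠ s := by rw [hA]; exact hjs _ h
          rw [hφ'old A hAs]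
          refine ⟨fun m' hm' => ?_, h2⟩
          rw [hc'old m' (by omega) (fun _ => by omega)]; exact h1 m' hm'
        · -- it is placed now (`j = j0`)
          have hAs : A = s := by rw [hA, hs]; congr 1; exact Fin.ext h
          obtain ⟨hsupp, -⟩ := hCoreA h.symm
          rw [hAs, hφ's]
          refine ⟨fun m' hm' => ?_, hsupp⟩
          rw [hc'old m' (by omega) (fun _ => by omega)]
          exact hψvan m' (by omega) (fun _ => by omega)
      · -- (B1) (B2)
        intro hjB'
        rcases Nat.lt_succ_iff_lt_or_eq.mp hjB' with h | h
        · -- the core was completed earlier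
          obtain ⟨h1, h2⟩ := hBc h
          have hBs : B ≠ s := by rw [hB]; exact hjs _ h
          have hAs : A ≠ s := by rw [hA]; exact hjs _ (by change j0 < j; omega)
          rw [hφ'old B hBs, hφ'old A hAs, hc'old ⟨j0, by omega⟩ (by change j0 < j; omega)
              (fun h' => absurd h' (by omega)),
            hc'old ⟨j0 + 1, by omega⟩ (by change j0 + 1 < j; omega) (fun _ => by change j0 + 1 ≠ j0; omega)]
          refine ⟨fun m' hm' => ?_, h2⟩
          rw [hc'old m' (by omega) (fun _ => by omega)]; exact h1 m' hm'
        · -- it is completed now (`j = j0 + 1`)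
          have hj : j = j0 + 1 := by omega
          have hBs : B = s := by rw [hB, hs]; congr 1; exact Fin.ext (by change j0 + 1 = j; omega)
          have hAs : A ≠ s := by rw [hA]; exact hjs _ (by change j0 < j; omega)
          obtain ⟨-, -, -, hM⟩ := hCoreB hj
          have hjf1 : (⟨j0 + 1, by omega⟩ : Fin n) = jf := Fin.ext (by change j0 + 1 = j; omega)
          rw [hBs, hφ's, hφ'old A hAs, hc'a hj, hjf1, hc'j]
          refine ⟨fun m' hm' => ?_, hM⟩
          rw [hc'old m' (by omega) (fun _ => by omega)]
          exact hψvan m' (by omega) (fun _ => by omega)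
      · -- (I)
        intro m m' hm hm' hcc
        -- values of `c'`: old columns (in `Used`), `ca`, `cj`
        have hval : ∀ m : Fin n, (m : ℕ) < j + 1 →
            (c' m = cj ∧ (m : ℕ) = j) ∨ (c' m = ca ∧ j = j0 + 1 ∧ (m : ℕ) = j0) ∨
              (c' m = c m ∧ c m ∈ Used ∧ (m : ℕ) < j ∧ (j = j0 + 1 → (m : ℕ) ≠ j0)) := by
          intro m hm
          by_cases h1 : (m : ℕ) = j
          · left; exact ⟨by simp [c', h1], h1⟩
          · by_cases h2 : j = j0 + 1 ∧ (m : ℕ) = j0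
            · right; left; refine ⟨?_, h2.1, h2.2⟩; simp only [c']; rw [if_neg h1, if_pos h2]
            · right; right
              have hm' : (m : ℕ) < j := by omega
              have hm'' : j = j0 + 1 → (m : ℕ) ≠ j0 := fun h e => h2 ⟨h, e⟩
              exact ⟨hc'old m hm' hm'', (hUsed_mem _).mpr ⟨m, ⟨hm', hm''⟩, rfl⟩, hm', hm''⟩
        have hcjU : cj ∉ Used := by
          by_cases hjA : j = j0
          · obtain ⟨-, hψcj⟩ := hCoreA hjA
            exact fun hU => hψcj (hψU cj hU)
          · by_cases hjB : j = j0 + 1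
            · exact (hCoreB hjB).2.1
            · exact (hGen hjA hjB).1
        rcases hval m hm with ⟨e1, f1⟩ | ⟨e1, f1, g1⟩ | ⟨e1, f1, g1, k1⟩ <;>
          rcases hval m' hm' with ⟨e2, f2⟩ | ⟨e2, f2, g2⟩ | ⟨e2, f2, g2, k2⟩
        · exact Fin.ext (f1.trans f2.symm)
        · rw [e1, e2] at hcc; exact absurd hcc.symm (hCoreB f2).2.2.1
        · rw [e1, e2] at hcc; exact absurd (hcc ▸ f2) hcjU
        · rw [e1, e2] at hcc; exact absurd hcc (hCoreB f1).2.2.1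
        · exact Fin.ext (g1.trans g2.symm)
        · rw [e1, e2] at hcc; exact absurd (hcc ▸ f2) (hCoreB f1).1
        · rw [e1, e2] at hcc; exact absurd (hcc.symm ▸ f1) hcjU
        · rw [e1, e2] at hcc; exact absurd (hcc.symm ▸ f1) (hCoreB f2).1
        · rw [e1, e2] at hcc; exact hI m m' g1 g2 hcc
  -- all positions processed: evaluate the permanent
  obtain ⟨φ, c, hK, hG, hAc, hBc, hI⟩ := step n le_rfl
  have hcinj : Function.Injective c := fun m m' h => hI m m' m.isLt m'.isLt h
  let cperm : Equiv.Perm (Fin n) := Equiv.ofBijective c (Finite.injective_iff_bijective.mp hcinj)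
  let τ : Equiv.Perm (Fin n) := ord.symm.trans cperm
  have hτ : ∀ i, τ i = c (ord.symm i) := fun i => rfl
  let L : Fin n → ℕ := fun i => if i = B then j0 else (ord.symm i : ℕ)
  have hLA : L A = j0 := by simp only [L, if_neg hAB]; exact hsA
  have hLB : L B = j0 := by simp [L]
  have hLo : ∀ i, i ≠ B → L i = (ord.symm i : ℕ) := fun i hi => by simp [L, hi]
  obtain ⟨hA1, -⟩ := hAc (by omega)
  obtain ⟨hB1, hM⟩ := hBc (by omega)
  refine ⟨φ, fun t => hK t (ord.symm (l t)).isLt, ?_⟩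
  rw [permanent_eq_of_block φ τ L A B hAB (hLA.trans hLB.symm) ?_ ?_]
  · refine mul_ne_zero (prod_ne_zero_iff.mpr fun i hi => ?_) ?_
    · rw [mem_erase, mem_erase] at hi
      have h1 : (ord.symm i : ℕ) ≠ j0 := fun h => hi.2.1 (by
        calc i = ord (ord.symm i) := (Equiv.apply_symm_apply _ _).symm
          _ = A := by rw [hA]; congr 1; exact Fin.ext h)
      have h2 : (ord.symm i : ℕ) ≠ j0 + 1 := fun h => hi.1 (by
        calc i = ord (ord.symm i) := (Equiv.apply_symm_apply _ _).symm
          _ = B := by rw [hB]; congr 1; exact Fin.ext h)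
      have := (hG (ord.symm i) (ord.symm i).isLt h1 h2).1
      rw [hτ]; simpa using this
    · rw [hτ A, hτ B]
      have eA : ord.symm A = ⟨j0, by omega⟩ := by rw [hA, Equiv.symm_apply_apply]
      have eB : ord.symm B = ⟨j0 + 1, by omega⟩ := by rw [hB, Equiv.symm_apply_apply]
      rw [eA, eB]; exact hM
  · -- levels: injective apart from the core pair
    intro i i' hii
    by_cases hiB : i = B
    · by_cases hi'B : i' = B
      · left; rw [hiB, hi'B]
      · right; right; refine ⟨hiB, ?_⟩
        rw [hiB, hLB, hLo i' hi'B] at hii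
        calc i' = ord (ord.symm i') := (Equiv.apply_symm_apply _ _).symm
          _ = A := by rw [hA]; congr 1; exact Fin.ext hii.symm
    · by_cases hi'B : i' = B
      · right; left; refine ⟨?_, hi'B⟩
        rw [hi'B, hLB, hLo i hiB] at hii
        calc i = ord (ord.symm i) := (Equiv.apply_symm_apply _ _).symm
          _ = A := by rw [hA]; congr 1; exact Fin.ext hii
      · left
        rw [hLo i hiB, hLo i' hi'B] at hii
        exact ord.symm.injective (Fin.ext hii)
  · -- block triangularity
    intro i i' hlt
    rw [hτ]
    by_cases hiB : i = B
    · rw [hiB, hLB] at hlt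
      have hi'B : i' ≠ B := fun h => by rw [h, hLB] at hlt; exact lt_irrefl _ hlt
      rw [hLo i' hi'B] at hlt
      rw [hiB]; exact hB1 (ord.symm i') hlt
    · rw [hLo i hiB] at hlt
      by_cases hiA : i = A
      · rw [hiA, hsA] at hlt
        have hi'B : i' ≠ B := fun h => by rw [h, hLB] at hlt; exact lt_irrefl _ hlt
        rw [hLo i' hi'B] at hlt
        rw [hiA]; exact hA1 (ord.symm i') hlt
      · -- a general row
        have h1 : (ord.symm i : ℕ) ≠ j0 := fun h => hiA (by
          calc i = ord (ord.symm i) := (Equiv.apply_symm_apply _ _).symm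
            _ = A := by rw [hA]; congr 1; exact Fin.ext h)
        have h2 : (ord.symm i : ℕ) ≠ j0 + 1 := fun h => hiB (by
          calc i = ord (ord.symm i) := (Equiv.apply_symm_apply _ _).symm
            _ = B := by rw [hB]; congr 1; exact Fin.ext h)
        have hlt' : ord.symm i' < ord.symm i := by
          by_cases hi'B : i' = B
          · rw [hi'B, hLB] at hlt; rw [hi'B, Fin.lt_def, hsB]; omega
          · rw [hLo i' hi'B] at hlt; rw [Fin.lt_def]; exact hlt
        have := (hG (ord.symm i) (ord.symm i).isLt h1 h2).2 (ord.symm i') hlt'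
        simpa using this

end LaplaceTriangular

end Summit.ValiantsHypothesis.ValiantsHypothesis.Theorems.RigidityForcesSymmetryRankRigidMinimalRepr
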